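import Literature.IUT.HodgeArakelov.TemperedThetaMonoidsCor37Proofs
import Literature.IUT.HodgeArakelov.GaloisPairRigidityGenuine
import HarnessLib

/-!
# [IUTchII] Corollary 3.7 (ii) UNCONDITIONAL at the genuine `AbsTopMonoids` producers — proof companion

S. Mochizuki, *Inter-universal Teichmüller theory II*, §3, kurims Dec-2020 manuscript, Corollary 3.7 (ii) p. 112 l. 7–37
«Uniradiality of Gaussian Monoids» [cite: Mochizuki2012, Cor 3.7 (ii) p.112]. Claim key DISPUTED (D-0012): nothing disputed is
asserted. PROOF-ONLY companion (abc-iut cell, layer L6, seat abc-iut-w4-d019 gen 4, row «IUTchII-COR37-DEF38-COVERAGE»; node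
**IUTchII:Cor3.7(ii)**): NO `def`, NO `structure`, NO `instance`, NO named fact. The transport theorem
`TemperedThetaMonoids.cor37ii_uniradialContent_of_prop34ii` (p446415) fed with abc-iut-w6-d010's / abc-iut-w5-d084's
UNCONDITIONAL Prop 3.4 (ii) content at the genuine producers `AbsTopMonoids.genuineOfModel(Ism)` (`O^⊳(G) := 𝒪_k̄^⊳` with the
genuine Galois action, `prop34iiUniradialContent_genuineOfModel(Ism)`, p429824): at every isomorph `G` of `G_k` and for EVERY
`G`-equivariant model `ιU : O^×(G) ⥲ U` of the unit group `Ψ_{F_ξ}(†F_v)^×` (the diagonal of Cor 3.6 (iii) read through the Kummer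
isomorphism of Cor 3.6 (i)), there is an automorphism of `U^{×μ}` commuting with every compatible `G`-action, induced by an
automorphism of the pair `G ↷ U` over `1 ∈ Aut(G)`, and induced through `ιU` by NO automorphism of the TM-pair `G ↷ O^⊳(G)` over
`1` — with NO named fact as hypothesis (the witness is inversion, `−1 ∈ Ẑ^×`). no side taken on [IUTchIII] Cor 3.12; typed ≠ proved.
-/

noncomputable section

namespace Literature.IUT.HodgeArakelov

namespace AbsTopMonoids

open CategoryTheory Literature.AnabelianGeometry.AbsoluteAnabelian TemperedThetaMonoids

variable (S : ThetaSetting.{0}) (C : MLFClosure.{0}) (ε : S.Gk ≃ₜ* (ModelMLFGaloisData.galois C.k C.K).tmPair.Pi)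
  (hΔ : ∀ f : S.PiX ≃ₜ* S.PiX, S.DeltaX.map f.toMulEquiv.toMonoidHom = S.DeltaX)
  (hq : Nonempty (TopGroup.quot S.PiX S.DeltaX ≃ₜ* S.Gk))

/-- **IUTchII:Cor3.7(ii) UNCONDITIONAL at the fully genuine producer `genuineOfModelIsm`** (kurims p. 112 l. 7–37 «fail to be
compatible, relative to the displayed diagrams of (i), with automorphisms of … the pair `G_v(M^Θ_*(†F_v))_⟨F_l^⋇⟩ ↷ Ψ_{F_ξ}(†F_v)^{×μ}`
which arise from automorphisms of … the pair `G_v(M^Θ_*(†F_v))_⟨F_l^⋇⟩ ↷ Ψ_{F_ξ}(†F_v)^×` … only admits a uniradial formulation»):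
the Gaussian uniradiality content at every `G`-equivariant model `U` of the unit group, no named fact.
[cite: Mochizuki2012, Cor 3.7 (ii) p.112] -/
theorem cor37ii_uniradialContent_genuineOfModelIsm (G : IsoClass S.Gk) {U : Type} [CommGroup U]
    (act : G.G →* MulAut U) (ιU : (genuineOfModelIsm S C ε hΔ hq).Ounits G ≃* U)
    (hι : ∀ (g : G.G) (x : (genuineOfModelIsm S C ε hΔ hq).Ounits G),
      ιU ((genuineOfModelIsm S C ε hΔ hq).actOunits G g x) = act g (ιU x)) :
    ∃ ψ : MulAut (U ⧸ CommGroup.torsion U),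
      (∀ actμ : G.G → (U ⧸ CommGroup.torsion U →* U ⧸ CommGroup.torsion U),
          (∀ (g : G.G) (x : U), actμ g (QuotientGroup.mk x) = QuotientGroup.mk (act g x)) →
          ∀ (g : G.G) (y : U ⧸ CommGroup.torsion U), ψ (actμ g y) = actμ g (ψ y)) ∧
      (∃ p : PairAut G U act, PairAut.forget p = 1 ∧
          ∀ x : U, (QuotientGroup.mk (p.1.2 x) : U ⧸ CommGroup.torsion U) = ψ (QuotientGroup.mk x)) ∧
      ∀ q : PairAut G ((genuineOfModelIsm S C ε hΔ hq).Otri G) ((genuineOfModelIsm S C ε hΔ hq).actOtri G),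
          PairAut.forget q = 1 →
          ∃ x : (genuineOfModelIsm S C ε hΔ hq).Ounits G,
            (QuotientGroup.mk (ιU (Units.map q.1.2.toMonoidHom x)) : U ⧸ CommGroup.torsion U) ≠
              ψ (QuotientGroup.mk (ιU x)) :=
  cor37ii_uniradialContent_of_prop34ii _ G (prop34iiUniradialContent_genuineOfModelIsm S C ε hΔ hq G) act ιU hι

/-- **IUTchII:Cor3.7(ii) UNCONDITIONAL at the genuine-mod-`ε` producer `genuineOfModel`** (same `O^⊳`/`O^×`/`O^{×μ}` sides
and `G`-actions). [cite: Mochizuki2012, Cor 3.7 (ii) p.112] -/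
theorem cor37ii_uniradialContent_genuineOfModel (G : IsoClass S.Gk) {U : Type} [CommGroup U]
    (act : G.G →* MulAut U) (ιU : (genuineOfModel S C ε hΔ hq).Ounits G ≃* U)
    (hι : ∀ (g : G.G) (x : (genuineOfModel S C ε hΔ hq).Ounits G),
      ιU ((genuineOfModel S C ε hΔ hq).actOunits G g x) = act g (ιU x)) :
    ∃ ψ : MulAut (U ⧸ CommGroup.torsion U),
      (∀ actμ : G.G → (U ⧸ CommGroup.torsion U →* U ⧸ CommGroup.torsion U),
          (∀ (g : G.G) (x : U), actμ g (QuotientGroup.mk x) = QuotientGroup.mk (act g x)) →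
          ∀ (g : G.G) (y : U ⧸ CommGroup.torsion U), ψ (actμ g y) = actμ g (ψ y)) ∧
      (∃ p : PairAut G U act, PairAut.forget p = 1 ∧
          ∀ x : U, (QuotientGroup.mk (p.1.2 x) : U ⧸ CommGroup.torsion U) = ψ (QuotientGroup.mk x)) ∧
      ∀ q : PairAut G ((genuineOfModel S C ε hΔ hq).Otri G) ((genuineOfModel S C ε hΔ hq).actOtri G),
          PairAut.forget q = 1 →
          ∃ x : (genuineOfModel S C ε hΔ hq).Ounits G,
            (QuotientGroup.mk (ιU (Units.map q.1.2.toMonoidHom x)) : U ⧸ CommGroup.torsion U) ≠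
              ψ (QuotientGroup.mk (ιU x)) :=
  cor37ii_uniradialContent_of_prop34ii _ G (prop34iiUniradialContent_genuineOfModel S C ε hΔ hq G) act ιU hι

/-- **IUTchII:Cor3.7(ii)**, the genuine unit group itself (`ιU := id`): at `O^×(G) = 𝒪_k̄^×` with the genuine Galois action,
INVERSION on `O^{×μ}(G)` is induced by the pair-automorphism `(1, x ↦ x⁻¹)` of `G ↷ O^×(G)` and by NO automorphism of
`G ↷ O^⊳(G)` over `1` — the Gaussian-shaped statement at the reference model of `Ψ_{F_ξ}(†F_v)^×`, no named fact.
[cite: Mochizuki2012, Cor 3.7 (ii) p.112] -/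
theorem cor37ii_uniradialContent_genuineOfModel_self (G : IsoClass S.Gk) :
    ∃ ψ : MulAut ((genuineOfModel S C ε hΔ hq).Oxmu G),
      (∃ p : PairAut G ((genuineOfModel S C ε hΔ hq).Ounits G) ((genuineOfModel S C ε hΔ hq).actOunits G),
          PairAut.forget p = 1 ∧
          ∀ x : (genuineOfModel S C ε hΔ hq).Ounits G,
            (QuotientGroup.mk (p.1.2 x) : (genuineOfModel S C ε hΔ hq).Oxmu G) = ψ (QuotientGroup.mk x)) ∧
      ∀ q : PairAut G ((genuineOfModel S C ε hΔ hq).Otri G) ((genuineOfModel S C ε hΔ hq).actOtri G),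
          PairAut.forget q = 1 →
          ∃ x : (genuineOfModel S C ε hΔ hq).Ounits G,
            (QuotientGroup.mk (Units.map q.1.2.toMonoidHom x) : (genuineOfModel S C ε hΔ hq).Oxmu G) ≠
              ψ (QuotientGroup.mk x) :=
  cor37ii_uniradialContent_self _ G (prop34iiUniradialContent_genuineOfModel S C ε hΔ hq G)

end AbsTopMonoids

end Literature.IUT.HodgeArakelov

end
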